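import Summits.KontsevichZagierPeriods.KontsevichZagierPeriods.Theorems.IsogenyCertificatesXMapKernelStubCMClassAux
import Summits.KontsevichZagierPeriods.KontsevichZagierPeriods.Theorems.IsogenyCertificatesXMapKernelStubClassReduction

/-!
# `XMapKernel`, line `isogeny-orbit-collapse` — stub **R-b3**: the CM class

Support file for the crux `IsogenyCertificates.XMapKernel` (stmt-KontsevichZagierPeriods-10663),
line `isogeny-orbit-collapse`, stub `stub_cmClass` (R-b3).

**Statement (R-b3).** Given the `Aut(ℂ)`-rigidity of lattice multipliers (R-b0) and the linear
independence of positive real radicals (R-b4), both taken as HYPOTHESES, let `L₀` be a lattice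
with rational invariants and WITH complex multiplication, and let `S` be a set of nonsingular
integral cubics `Pⱼ = x³ + Aⱼx + Bⱼ` whose period lattices `Λⱼ` (invariants `(−4Aⱼ, −4Bⱼ)`) all
receive a non-zero multiple `αⱼΛ₀ ⊆ Λⱼ` of `Λ₀`, pairwise without rational lattice multiplier.
Then a vanishing rational combination `∑_{j ∈ S} qⱼ Ωⱼ = 0` of the full real periods
`Ωⱼ = ∫_{Pⱼ > 0} dx/√Pⱼ` is trivial. No transcendence is needed in the CM class.

**Proof.** `Λ₀` is real (rational invariants, `isReal_of_g₂_g₃_real`); let `u = Ω₀(Λ₀) > 0` be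
its least positive real period and `τ ∉ ℝ`, `τΛ₀ ⊆ Λ₀`, `τ² = pτ + q` its CM multiplier
(auxiliary file, `exists_cm_multiplier`), `K = ℚ + ℚτ`.
1. *Spans.* `Λ₀ ⊆ K·u` (`lattice_subset_qtau_mul`). For `j ∈ S`, `Λⱼ` is the real lattice of
   `y² = Pⱼ` (`ClassReduction.exists_periodPair`, `uniformization_unique_holds`),
   `Ωⱼ = nⱼ·wⱼ` with `wⱼ = Ω₀(Λⱼ) ∈ Λⱼ`, `nⱼ ∈ {1, 2}`; `NⱼΛⱼ ⊆ αⱼΛ₀` for some `Nⱼ ≥ 1`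
   (`exists_nat_mul_mem_of_le`), so `Nⱼτ` is a CM multiplier of `Λⱼ`, `Λⱼ ⊆ K·wⱼ`, and
   `ρⱼ := wⱼ/u = κⱼαⱼ` with `κⱼ ∈ K`.
2. *Rigidity ⇒ radicals.* For `σ ∈ Aut(ℂ)`, `σ(αⱼ)Λ₀ ⊆ Λⱼ` (R-b0), so
   `σ(αⱼ)u ∈ Λⱼ ⊆ K·wⱼ`, i.e. `σ(αⱼ) ∈ K·ρⱼ`, and `σ(ρⱼ) = σ(κⱼ)σ(αⱼ) ∈ K·ρⱼ` (`K` is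
   `Aut(ℂ)`-stable and multiplicatively closed). As `ρⱼ > 0` is algebraic
   (`isAlgebraic_of_mul_mem_lattice`), the norm argument of the auxiliary file
   (`stub_cmClass_powRational`) gives `ρⱼ^{dⱼ} ∈ ℚ`, hence `ρⱼ^m ∈ ℚ` for `m = ∏ dⱼ`.
3. *No rational multiplier ⇒ irrational ratios.* If `ρⱼ = cρⱼ'` with `c ∈ ℚ` (`j ≠ j'`), then
   `Λⱼ ⊆ K·wⱼ = K·wⱼ' = ℚwⱼ' + ℚ(Nⱼ'τwⱼ') ⊆ ℚΛⱼ'`, so `MΛⱼ ⊆ Λⱼ'` for an integer `M ≥ 1`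
   (`exists_nat_mul_qcomb_mem` on the two generators) — a rational lattice multiplier, excluded.
4. *Conclusion.* Dividing the relation by `u`: `∑_{j ∈ S} (qⱼnⱼ)ρⱼ = 0` with `ρⱼ > 0`,
   `ρⱼ^m ∈ ℚ`, pairwise irrational ratios; R-b4 (re-indexed by `Finset.equivFin`) gives
   `qⱼnⱼ = 0`, so `qⱼ = 0`.

No definitions, no new named facts; R-b0 and R-b4 enter as hypotheses, verbatim their
registered signatures.

References: D. A. Cox, *Primes of the form x² + ny²* (2013), Thm. 10.14, §10.C;
J. H. Silverman, *The Arithmetic of Elliptic Curves* (2009), Thm. VI.5.1, C.16;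
L. J. Mordell, Pacific J. Math. 3 (1953), Thm. 1.
-/

noncomputable section

namespace Summit.KontsevichZagierPeriods.IsogenyCertificates.XMapKernelStubs.CMClass

open scoped BigOperators
open Complex Literature.NumberTheory.Transcendental
open Summit.KontsevichZagierPeriods.IsogenyCertificates.EffectiveXMapChainsNegative

/-- **R-b3 — the CM class.** Given `Aut(ℂ)`-rigidity of lattice multipliers (R-b0) and the
linear independence of positive real radicals (R-b4) as hypotheses: a vanishing `ℚ`-combination
`∑_{j ∈ S} qⱼ Ωⱼ = 0` of full real periods `Ωⱼ = ∫_{Pⱼ > 0} dx/√Pⱼ` of nonsingular integral cubics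
`Pⱼ = x³ + Aⱼx + Bⱼ`, supported on curves whose period lattices `Λⱼ` (invariants
`(−4Aⱼ, −4Bⱼ)`) all receive a non-zero multiple of ONE lattice `Λ₀` with rational invariants
and complex multiplication by `K = ℚ(τ)`, pairwise without rational lattice multiplier, is
trivial. Proof in the module docstring: all `Λⱼ` span `K·Ω₀(Λⱼ)` over `ℚ`, rigidity puts every
conjugate of `ρⱼ = Ω₀(Λⱼ)/Ω₀(Λ₀)` in `K·ρⱼ` so that `ρⱼ^m ∈ ℚ` (norm argument,
`stub_cmClass_powRational`), commensurable spans would give a rational multiplier, and R-b4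
concludes. [cite: Cox2013, Thm. 10.14 and §10.C] -/
theorem stub_cmClass : (∀ (L L' : PeriodPair) (γ : ℂ) (σ : ℂ ≃+* ℂ), (∃ q : ℚ, (q : ℂ) = L.g₂) → (∃ q : ℚ, (q : ℂ) = L.g₃) → (∃ q : ℚ, (q : ℂ) = L'.g₂) → (∃ q : ℚ, (q : ℂ) = L'.g₃) → γ ≠ 0 → (∀ l ∈ L.lattice, γ * l ∈ L'.lattice) → ∀ l ∈ L.lattice, σ γ * l ∈ L'.lattice) → (∀ (m : ℕ), 0 < m → ∀ (r : ℕ) (x : Fin r → ℝ) (c : Fin r → ℚ), (∀ j, 0 < x j) → (∀ j, ∃ a : ℚ, x j ^ m = (a : ℝ)) → (∀ j j', j ≠ j' → ¬ ∃ a : ℚ, x j = (a : ℝ) * x j') → ∑ j, (c j : ℝ) * x j = 0 → ∀ j, c j = 0) → ∀ (k : ℕ) (A B : Fin k → ℤ) (q : Fin k → ℚ) (S : Finset (Fin k)) (L₀ : PeriodPair), (∀ i, 4 * A i ^ 3 + 27 * B i ^ 2 ≠ 0) → (∃ q₀ : ℚ, (q₀ : ℂ) = L₀.g₂) → (∃ q₀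 : ℚ, (q₀ : ℂ) = L₀.g₃) → L₀.HasCM → (∀ j ∈ S, ∃ (L' : PeriodPair) (α : ℂ), L'.g₂ = -4 * (A j : ℂ) ∧ L'.g₃ = -4 * (B j : ℂ) ∧ α ≠ 0 ∧ ∀ l ∈ L₀.lattice, α * l ∈ L'.lattice) → (∀ i ∈ S, ∀ j ∈ S, i ≠ j → ¬ ∃ (L L' : PeriodPair) (c : ℚ), L.g₂ = -4 * (A i : ℂ) ∧ L.g₃ = -4 * (B i : ℂ) ∧ L'.g₂ = -4 * (A j : ℂ) ∧ L'.g₃ = -4 * (B j : ℂ) ∧ c ≠ 0 ∧ ∀ l ∈ L.lattice, (c : ℂ) * l ∈ L'.lattice) → ∑ j ∈ S, (q j : ℝ) * (∫ x in {x : Fin 1 → ℝ | 0 < x 0 ^ 3 + (A j : ℝ) * x 0 + (B j : ℝ)}, 1 / Real.sqrt (x 0 ^ 3 + (A j : ℝ) * x 0 + (B j : ℝ))) = 0 → ∀ j ∈ S, q j = 0 := by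
  intro hRig hLIR k A B q S L₀ hns hg₂ hg₃ hCM hmem hnrm hsum
  classical
  -- (0) the real period lattices `Λⱼ`, `Ωⱼ = nⱼ wⱼ`, `nⱼ ∈ {1, 2}`, `wⱼ = Ω₀(Λⱼ)`
  choose L hLg₂ hLg₃ hLreal hLΩ using fun j => ClassReduction.exists_periodPair (hns j)
  obtain ⟨n, hn⟩ : ∃ n : Fin k → ℕ, ∀ j, (curve (A j) (B j)).numRealComponents = n j :=
    ⟨_, fun j => rfl⟩
  have hn0 : ∀ j, n j ≠ 0 := fun j => by
    rw [← hn]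
    exact (curve (A j) (B j)).numRealComponents_pos.ne'
  obtain ⟨w, hw⟩ : ∃ w : Fin k → ℝ, ∀ j, w j = (L j).minRealPeriod := ⟨_, fun j => rfl⟩
  have hwpos : ∀ j, 0 < w j := fun j => by rw [hw]; exact (hLreal j).minRealPeriod_pos
  have hwL : ∀ j, ((w j : ℝ) : ℂ) ∈ (L j).lattice := fun j => by
    rw [hw]; exact (hLreal j).minRealPeriod_mem_lattice
  have hLg₂' : ∀ j, ∃ r : ℚ, (r : ℂ) = (L j).g₂ := fun j =>
    ⟨-4 * A j, by rw [hLg₂]; push_cast; ring⟩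
  have hLg₃' : ∀ j, ∃ r : ℚ, (r : ℂ) = (L j).g₃ := fun j =>
    ⟨-4 * B j, by rw [hLg₃]; push_cast; ring⟩
  have hLalg : ∀ j, IsAlgebraic ℚ (L j).g₂ ∧ IsAlgebraic ℚ (L j).g₃ := by
    intro j
    obtain ⟨r₂, hr₂⟩ := hLg₂' j
    obtain ⟨r₃, hr₃⟩ := hLg₃' j
    exact ⟨by rw [← hr₂]; exact isAlgebraic_algebraMap r₂,
      by rw [← hr₃]; exact isAlgebraic_algebraMap r₃⟩
  have h₀alg : IsAlgebraic ℚ L₀.g₂ ∧ IsAlgebraic ℚ L₀.g₃ := by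
    obtain ⟨r₂, hr₂⟩ := hg₂
    obtain ⟨r₃, hr₃⟩ := hg₃
    exact ⟨by rw [← hr₂]; exact isAlgebraic_algebraMap r₂,
      by rw [← hr₃]; exact isAlgebraic_algebraMap r₃⟩
  -- (1) the multipliers `αⱼΛ₀ ⊆ Λⱼ` (a lattice with the invariants of `Λⱼ` is `Λⱼ`)
  have hmem' : ∀ j ∈ S, ∃ α : ℂ, α ≠ 0 ∧ ∀ l ∈ L₀.lattice, α * l ∈ (L j).lattice := by
    intro j hj
    obtain ⟨L', α, h₂, h₃, hα, hαL⟩ := hmem j hj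
    have hlat : L'.lattice = (L j).lattice :=
      PeriodPair.uniformization_unique_holds L' (L j) (h₂.trans (hLg₂ j).symm)
        (h₃.trans (hLg₃ j).symm)
    exact ⟨α, hα, fun l hl => hlat ▸ hαL l hl⟩
  choose! α hα0 hαL using hmem'
  have hRig' : ∀ j ∈ S, ∀ σ : ℂ ≃+* ℂ, ∀ l ∈ L₀.lattice, σ (α j) * l ∈ (L j).lattice :=
    fun j hj σ => hRig L₀ (L j) (α j) σ hg₂ hg₃ (hLg₂' j) (hLg₃' j) (hα0 j hj) (hαL j hj)
  have hαalg : ∀ j ∈ S, IsAlgebraic ℚ (α j) := fun j hj =>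
    HuberWustholzSplitting.isAlgebraic_of_mul_mem_lattice h₀alg.1 h₀alg.2 (hLalg j).1
      (hLalg j).2 (hα0 j hj) (hαL j hj)
  -- (2) `Λ₀` is real; `u = Ω₀(Λ₀) > 0`
  have hreal₀ : L₀.IsReal := by
    obtain ⟨r₂, hr₂⟩ := hg₂
    obtain ⟨r₃, hr₃⟩ := hg₃
    exact PeriodPair.isReal_of_g₂_g₃_real PeriodPair.uniformization_unique_holds
      (by rw [← hr₂]; exact ratCast_im r₂) (by rw [← hr₃]; exact ratCast_im r₃)
  obtain ⟨u, hu_def⟩ : ∃ u : ℝ, u = L₀.minRealPeriod := ⟨_, rfl⟩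
  have hu : 0 < u := by rw [hu_def]; exact hreal₀.minRealPeriod_pos
  have huL : (u : ℂ) ∈ L₀.lattice := by rw [hu_def]; exact hreal₀.minRealPeriod_mem_lattice
  have huc : (u : ℂ) ≠ 0 := by exact_mod_cast hu.ne'
  -- (3) the CM multiplier `τ`, `τ² = pτ + q'`, and `Λ₀ ⊆ (ℚ + ℚτ)u`
  obtain ⟨τ, p, q', hτ, hτL, hquad⟩ := exists_cm_multiplier hCM
  have hΛ₀ := lattice_subset_qtau_mul hτ hτL hu.ne' huL
  -- (4) `NⱼΛⱼ ⊆ αⱼΛ₀`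
  have hN : ∀ j ∈ S, ∃ N : ℕ, N ≠ 0 ∧
      ∀ y ∈ (L j).lattice, ∃ l ∈ L₀.lattice, (N : ℂ) * y = α j * l := by
    intro j hj
    have hαi : (α j)⁻¹ ≠ 0 := inv_ne_zero (hα0 j hj)
    have hle : L₀.lattice ≤ ((L j).mulLeft (α j)⁻¹ hαi).lattice := fun l hl =>
      PeriodPair.mem_mulLeft_lattice.2 (by rw [inv_inv]; exact hαL j hj l hl)
    obtain ⟨N, hN, hNM⟩ := HuberWustholzSplitting.exists_nat_mul_mem_of_le hle
    refine ⟨N, hN, fun y hy => ⟨(α j)⁻¹ * ((N : ℂ) * y), ?_, ?_⟩⟩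
    · have h1 := hNM ((α j)⁻¹ * y) (PeriodPair.mem_mulLeft_lattice.2
        (by rw [inv_inv, ← mul_assoc, mul_inv_cancel₀ (hα0 j hj), one_mul]; exact hy))
      have e : (α j)⁻¹ * ((N : ℂ) * y) = (N : ℂ) * ((α j)⁻¹ * y) := by ring
      rw [e]
      exact h1
    · rw [← mul_assoc, mul_inv_cancel₀ (hα0 j hj), one_mul]
  choose! N hN0 hNL using hN
  -- `Nⱼτ` is a CM multiplier of `Λⱼ`, so `Λⱼ ⊆ (ℚ + ℚτ)wⱼ`
  have hτj : ∀ j ∈ S, ∀ y ∈ (L j).lattice, (N j : ℂ) * τ * y ∈ (L j).lattice := by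
    intro j hj y hy
    obtain ⟨l, hl, hNy⟩ := hNL j hj y hy
    have e : (N j : ℂ) * τ * y = α j * (τ * l) := by
      calc (N j : ℂ) * τ * y = τ * ((N j : ℂ) * y) := by ring
        _ = α j * (τ * l) := by rw [hNy]; ring
    rw [e]
    exact hαL j hj _ (hτL l hl)
  have hΛj : ∀ j ∈ S, ∀ y ∈ (L j).lattice, ∃ a b : ℚ, y = ((a : ℂ) + b * τ) * (w j) := by
    intro j hj y hy
    have hτ' : ((N j : ℂ) * τ).im ≠ 0 := by
      rw [show ((N j : ℂ) * τ).im = (N j : ℝ) * τ.im by simp]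
      exact mul_ne_zero (by exact_mod_cast hN0 j hj) hτ
    obtain ⟨a, b, hab⟩ := lattice_subset_qtau_mul hτ' (fun y hy => hτj j hj y hy)
      (hwpos j).ne' (hwL j) y hy
    exact ⟨a, b * N j, by rw [hab]; push_cast; ring⟩
  -- (5) the ratios `ρⱼ = wⱼ/u = κⱼαⱼ`, `κⱼ ∈ ℚ + ℚτ`
  obtain ⟨ρ, hρ⟩ : ∃ ρ : Fin k → ℝ, ∀ j, ρ j = w j / u := ⟨_, fun j => rfl⟩
  have hρpos : ∀ j, 0 < ρ j := fun j => by rw [hρ]; exact div_pos (hwpos j) hu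
  have hρw : ∀ j, (w j : ℂ) = ρ j * u := fun j => by
    rw [hρ]; push_cast; field_simp
  have hρκ : ∀ j ∈ S, ∃ a b : ℚ, (ρ j : ℂ) = ((a : ℂ) + b * τ) * α j := by
    intro j hj
    obtain ⟨l, hl, hNw⟩ := hNL j hj _ (hwL j)
    obtain ⟨a, b, hab⟩ := hΛ₀ l hl
    have hNc : (N j : ℂ) ≠ 0 := by exact_mod_cast hN0 j hj
    refine ⟨a / N j, b / N j, ?_⟩
    rw [hab, hρw] at hNw
    have h1 : (N j : ℂ) * ρ j = α j * ((a : ℂ) + b * τ) := by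
      apply mul_right_cancel₀ huc
      linear_combination hNw
    push_cast
    field_simp
    linear_combination h1
  -- (6) rigidity: every conjugate of `ρⱼ` lies in `(ℚ + ℚτ)ρⱼ`
  have hconj : ∀ j ∈ S, ∀ σ : ℂ ≃+* ℂ, ∃ a b : ℚ,
      σ (ρ j : ℂ) = ((a : ℂ) + b * τ) * (ρ j : ℂ) := by
    intro j hj σ
    obtain ⟨a₁, b₁, h₁⟩ := hΛj j hj _ (hRig' j hj σ _ huL)
    obtain ⟨a₂, b₂, h₂⟩ := hρκ j hj
    obtain ⟨a₃, b₃, h₃⟩ := ringEquiv_apply_qtau hquad σ a₂ b₂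
    obtain ⟨a₄, b₄, h₄⟩ := qtau_mul hquad a₃ b₃ a₁ b₁
    refine ⟨a₄, b₄, ?_⟩
    have e1 : σ (ρ j : ℂ) = ((a₃ : ℂ) + b₃ * τ) * σ (α j) := by rw [h₂, map_mul, h₃]
    rw [hρw] at h₁
    have e2 : σ (α j) = ((a₁ : ℂ) + b₁ * τ) * ρ j := by
      have := mul_right_cancel₀ huc (h₁.trans (mul_assoc _ _ _).symm)
      exact this
    rw [e1, e2]
    linear_combination (ρ j : ℂ) * h₄
  -- (7) the norm argument: `ρⱼ^m ∈ ℚ` for a common exponent `m ≥ 1`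
  have hτalg : IsAlgebraic ℚ τ := isAlgebraic_tau hquad
  have hρalg : ∀ j ∈ S, IsAlgebraic ℚ (ρ j : ℂ) := by
    intro j hj
    obtain ⟨a, b, hab⟩ := hρκ j hj
    rw [hab]
    exact ((isAlgebraic_algebraMap a).add ((isAlgebraic_algebraMap b).mul hτalg)).mul
      (hαalg j hj)
  have hpow : ∀ j ∈ S, ∃ d : ℕ, 0 < d ∧ ∃ r : ℚ, ρ j ^ d = (r : ℝ) := fun j hj =>
    stub_cmClass_powRational τ p q' hτ hquad (ρ j) (hρpos j).ne' (hρalg j hj) (hconj j hj)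
  choose! d hd hdr using hpow
  have hm : 0 < ∏ j ∈ S, d j := Finset.prod_pos fun j hj => hd j hj
  have hxm : ∀ j ∈ S, ∃ a : ℚ, ρ j ^ (∏ i ∈ S, d i) = (a : ℝ) := by
    intro j hj
    obtain ⟨r, hr⟩ := hdr j hj
    obtain ⟨e, he⟩ : d j ∣ ∏ i ∈ S, d i := Finset.dvd_prod_of_mem d hj
    exact ⟨r ^ e, by rw [he, pow_mul, hr]; push_cast; rfl⟩
  -- (8) no rational multiplier ⇒ pairwise irrational ratios
  have hirr : ∀ j ∈ S, ∀ j' ∈ S, j ≠ j' → ¬ ∃ c : ℚ, ρ j = (c : ℝ) * ρ j' := by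
    rintro j hj j' hj' hne ⟨c, hc⟩
    have hww : (w j : ℂ) = (c : ℂ) * w j' := by
      rw [hρw, hρw]
      have : (ρ j : ℂ) = (c : ℂ) * ρ j' := by exact_mod_cast congrArg ((↑) : ℝ → ℂ) hc
      rw [this, mul_assoc]
    -- every vector of `Λⱼ` is a rational combination of `wⱼ'` and `Nⱼ'τwⱼ' ∈ Λⱼ'`
    have hgen : ∀ y ∈ (L j).lattice, ∃ D : ℕ, D ≠ 0 ∧ (D : ℂ) * y ∈ (L j').lattice := by
      intro y hy
      obtain ⟨a, b, hab⟩ := hΛj j hj y hy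
      have hNc : (N j' : ℂ) ≠ 0 := by exact_mod_cast hN0 j' hj'
      have e : y = ((a * c : ℚ) : ℂ) * (w j' : ℂ) +
          ((b * c / N j' : ℚ) : ℂ) * ((N j' : ℂ) * τ * w j') := by
        rw [hab, hww]
        push_cast
        field_simp
      rw [e]
      exact exists_nat_mul_qcomb_mem (hwL j') (hτj j' hj' _ (hwL j')) _ _
    obtain ⟨D₁, hD₁, hD₁L⟩ := hgen _ (L j).ω₁_mem_lattice
    obtain ⟨D₂, hD₂, hD₂L⟩ := hgen _ (L j).ω₂_mem_lattice
    refine hnrm j hj j' hj' hne ⟨L j, L j', ((D₁ * D₂ : ℕ) : ℚ), hLg₂ j, hLg₃ j, hLg₂ j',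
      hLg₃ j', by exact_mod_cast mul_ne_zero hD₁ hD₂, fun l hl => ?_⟩
    obtain ⟨m₁, m₂, rfl⟩ := PeriodPair.mem_lattice.1 hl
    have e : (((D₁ * D₂ : ℕ) : ℚ) : ℂ) * ((m₁ : ℂ) * (L j).ω₁ + m₂ * (L j).ω₂)
        = ((m₁ * D₂ : ℤ) : ℂ) * ((D₁ : ℂ) * (L j).ω₁) +
          ((m₂ * D₁ : ℤ) : ℂ) * ((D₂ : ℂ) * (L j).ω₂) := by
      push_cast
      ring
    rw [e]
    exact add_mem (intCast_mul_mem _ hD₁L) (intCast_mul_mem _ hD₂L)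
  -- (9) the relation `∑_{j ∈ S} (qⱼnⱼ) ρⱼ = 0`
  obtain ⟨c, hc⟩ : ∃ c : Fin k → ℚ, ∀ j, c j = q j * n j := ⟨_, fun j => rfl⟩
  have hrel : ∑ j ∈ S, (c j : ℝ) * ρ j = 0 := by
    simp only [hLΩ, hn] at hsum
    have e : ∑ j ∈ S, (c j : ℝ) * ρ j =
        (∑ j ∈ S, (q j : ℝ) * ((n j : ℝ) * (L j).minRealPeriod)) / u := by
      rw [Finset.sum_div]
      refine Finset.sum_congr rfl fun j _ => ?_
      rw [hc, hρ, hw]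
      push_cast
      ring
    rw [e, hsum, zero_div]
  -- (10) radical independence (R-b4) on `S`, re-indexed by `Fin #S`
  have key : ∀ j ∈ S, c j = 0 := by
    intro j hj
    set eS := S.equivFin with heS
    have H := hLIR (∏ i ∈ S, d i) hm S.card (fun i => ρ (eS.symm i)) (fun i => c (eS.symm i))
      (fun i => hρpos _) (fun i => hxm _ (eS.symm i).2)
      (fun i i' hii' => hirr _ (eS.symm i).2 _ (eS.symm i').2
        (fun h => hii' (eS.symm.injective (Subtype.ext h))))
      (by
        calc ∑ i, ((c (eS.symm i) : ℚ) : ℝ) * ρ (eS.symm i)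
            = ∑ y : {y // y ∈ S}, ((c y : ℚ) : ℝ) * ρ y :=
              eS.symm.sum_comp (fun y : {y // y ∈ S} => ((c y : ℚ) : ℝ) * ρ y)
          _ = ∑ y ∈ S, ((c y : ℚ) : ℝ) * ρ y := Finset.sum_coe_sort S (fun y => ((c y : ℚ) : ℝ) * ρ y)
          _ = 0 := hrel)
    have hcj := H (eS ⟨j, hj⟩)
    simpa only [Equiv.symm_apply_apply] using hcj
  -- (11) conclusion: `qⱼnⱼ = 0` with `nⱼ ≠ 0`
  intro j hj
  have hcj := key j hj
  rw [hc] at hcj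
  rcases mul_eq_zero.1 hcj with h | h
  · exact h
  · exact absurd (by exact_mod_cast h) (hn0 j)

end Summit.KontsevichZagierPeriods.IsogenyCertificates.XMapKernelStubs.CMClass
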